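import Summits.FinalStateConjecture.FinalStateConjecture.Theorems.UniformPhotonSphereChannels.Negative.CauchyC3
import Summits.FinalStateConjecture.FinalStateConjecture.Theorems.PhotonSphereChannelsCauchyWave
import Summits.FinalStateConjecture.FinalStateConjecture.Theorems.PhotonSphereChannelsParametricPrimitive
import Summits.FinalStateConjecture.FinalStateConjecture.Theorems.PhotonSphereChannelsExteriorEnergy
import Summits.FinalStateConjecture.FinalStateConjecture.Theorems.PhotonSphereChannelsUniformPhotonSphereChannelsNearKernelCensus

/-!
# Route PhotonSphereChannels — the 1+1 wave equation with a potential: `C³` solutions with ODD data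
# by time-integration of even `C³` solutions; the Regge–Wheeler Cauchy problem `(0, g)` in `C³`

Support file for the crux chain of `UniformPhotonSphereChannels` (K1, stmt-FinalStateConjecture-10045),
line `kruskal-rest-frame-virial`, registered stub **`stub_rwCauchyC3`** (lead's reshape v2), and for the
ex-falso settlement of K2 `ChannelsResolveTameDevelopments` (stmt-FinalStateConjecture-10046), whose
antecedent is K1.

* `WaveEnergy.timePrimitive_isSolution` — if `φ ∈ C³(ℝ²)` solves `φ_tt − φ_xx + Vφ = 0` (slice
  `iteratedDeriv` form of the route) with `φ_t(0,·) = 0`, then its time primitive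
  `ψ(t,x) = ∫₀ᵗ φ(s,x) ds` is `C³`, solves the same equation, and has data `(0, φ(0,·))`:
  `ψ_t = φ`, `ψ_tt = φ_t`, `ψ_xx = ∫₀ᵗ φ_xx = ∫₀ᵗ (φ_tt + Vφ) = φ_t(t,·) − φ_t(0,·) + Vψ = φ_t + Vψ`.
* `WaveEnergy.rw_exists_odd_solution_C3` — the registered signature: along a tortoise radius function,
  `s ≤ ℓ`, `g ∈ C³` vanishing off `(α, β)`, a global `C³` Regge–Wheeler solution with `ψ(0,·) = 0`,
  `ψ_t(0,·) = g`, vanishing on `{x + |t| ≤ α} ∪ {β + |t| ≤ x}` — the time primitive of the even `C³`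
  solution `Blindness.exists_even_solution_C3` with data `(g, 0)`.

No definitions. [folklore]
-/

noncomputable section

open Set Filter MeasureTheory intervalIntegral Topology Function

namespace Summit.FinalStateConjecture.FinalStateConjecture.Theorems

namespace WaveEnergy

variable {φ : ℝ → ℝ → ℝ}

/-- `uncurry` of the time primitive is the parametric primitive of `uncurry φ`. -/
theorem uncurry_timePrimitive (φ : ℝ → ℝ → ℝ) :
    uncurry (fun t x => ∫ s in (0 : ℝ)..t, φ s x)
      = fun q : ℝ × ℝ => ∫ s in (0 : ℝ)..q.1, uncurry φ (s, q.2) := by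
  funext q
  rfl

/-- The time primitive of a `Cⁿ` function of `(t, x)` is `Cⁿ`. -/
theorem contDiff_timePrimitive (n : ℕ) (hφ : ContDiff ℝ n (uncurry φ)) :
    ContDiff ℝ n (uncurry fun t x => ∫ s in (0 : ℝ)..t, φ s x) := by
  rw [uncurry_timePrimitive]
  exact contDiff_parametric_primitive_nat (Q := ℝ) n hφ

/-- FTC for the time primitive: `∂_t ∫₀ᵗ φ(s,x) ds = φ(t,x)`. -/
theorem hasDerivAt_timePrimitive (hφ : Continuous (uncurry φ)) (t x : ℝ) :
    HasDerivAt (fun τ => ∫ s in (0 : ℝ)..τ, φ s x) (φ t x) t := by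
  have hc : Continuous fun s => φ s x := hφ.comp (continuous_id.prodMk continuous_const)
  exact intervalIntegral.integral_hasDerivAt_right (hc.intervalIntegrable _ _)
    hc.aestronglyMeasurable.stronglyMeasurableAtFilter hc.continuousAt

/-- `deriv` form of the FTC for the time primitive. -/
theorem deriv_timePrimitive (hφ : Continuous (uncurry φ)) (t x : ℝ) :
    deriv (fun τ => ∫ s in (0 : ℝ)..τ, φ s x) t = φ t x :=
  (hasDerivAt_timePrimitive hφ t x).deriv

/-- Differentiation under the integral in `x`: `∂ₓ ∫₀ᵗ φ(s,·) = ∫₀ᵗ ∂ₓφ(s,·)` for `φ ∈ C¹`. -/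
theorem deriv_timePrimitive_snd (hφ : ContDiff ℝ 1 (uncurry φ)) (t x : ℝ) :
    deriv (fun y => ∫ s in (0 : ℝ)..t, φ s y) x
      = ∫ s in (0 : ℝ)..t, fderiv ℝ (uncurry φ) (s, x) (0, 1) := by
  have h := Literature.Analysis.FunctionSpaces.fderiv_parametric_intervalIntegral_apply
    (P := ℝ) (H := uncurry φ) hφ (by simp) 0 t x 1
  exact h

/-- Second `x`-derivative under the integral: `∂ₓ² ∫₀ᵗ φ(s,·) = ∫₀ᵗ ∂ₓ²φ(s,·)` for `φ ∈ C²`. -/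
theorem iteratedDeriv_two_timePrimitive_snd (hφ : ContDiff ℝ 2 (uncurry φ)) (t x : ℝ) :
    iteratedDeriv 2 (fun y => ∫ s in (0 : ℝ)..t, φ s y) x
      = ∫ s in (0 : ℝ)..t, fderiv ℝ (fderiv ℝ (uncurry φ)) (s, x) (0, 1) (0, 1) := by
  rw [iteratedDeriv_succ, iteratedDeriv_one]
  have h1 : deriv (fun y => ∫ s in (0 : ℝ)..t, φ s y)
      = fun y => ∫ s in (0 : ℝ)..t, fderiv ℝ (uncurry φ) (s, y) (0, 1) :=
    funext fun y => deriv_timePrimitive_snd (hφ.of_le (by norm_num)) t y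
  rw [h1]
  -- the integrand `(s, y) ↦ ∂φ(s,y)(0,1)` is `C¹`
  have hH₁ : ContDiff ℝ 1 (fun q : ℝ × ℝ => fderiv ℝ (uncurry φ) q ((0 : ℝ), (1 : ℝ))) :=
    (hφ.fderiv_right (m := 1) le_rfl).clm_apply contDiff_const
  have h2 := Literature.Analysis.FunctionSpaces.fderiv_parametric_intervalIntegral_apply
    (P := ℝ) (H := fun q : ℝ × ℝ => fderiv ℝ (uncurry φ) q ((0 : ℝ), (1 : ℝ))) hH₁ (by simp) 0 t x 1
  change fderiv ℝ (fun y => ∫ s in (0 : ℝ)..t, fderiv ℝ (uncurry φ) (s, y) (0, 1)) x 1 = _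
  rw [h2]
  refine intervalIntegral.integral_congr fun s _ => ?_
  exact fderiv_fderiv_apply hφ (s, x) (0, 1) (0, 1)

/-- FTC for the time partial: `∫₀ᵗ φ_tt(s,x) ds = φ_t(t,x) − φ_t(0,x)` (`φ ∈ C²`, Fréchet form). -/
theorem integral_fderiv_fderiv_fst (hφ : ContDiff ℝ 2 (uncurry φ)) (t x : ℝ) :
    ∫ s in (0 : ℝ)..t, fderiv ℝ (fderiv ℝ (uncurry φ)) (s, x) (1, 0) (1, 0)
      = fderiv ℝ (uncurry φ) (t, x) (1, 0) - fderiv ℝ (uncurry φ) (0, x) (1, 0) := by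
  have hderiv : ∀ s ∈ uIcc (0 : ℝ) t,
      HasDerivAt (fun σ => fderiv ℝ (uncurry φ) (σ, x) (1, 0))
        (fderiv ℝ (fderiv ℝ (uncurry φ)) (s, x) (1, 0) (1, 0)) s :=
    fun s _ => hasDerivAt_fderiv_apply_slice_fst hφ (1, 0) s x
  have hcont : Continuous fun σ : ℝ => fderiv ℝ (fderiv ℝ (uncurry φ)) (σ, x) (1, 0) (1, 0) := by
    have hc : Continuous (fderiv ℝ (fderiv ℝ (uncurry φ))) :=
      (hφ.fderiv_right (m := 1) le_rfl).continuous_fderiv (by simp)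
    exact ((hc.comp (continuous_id.prodMk continuous_const)).clm_apply continuous_const).clm_apply
      continuous_const
  exact intervalIntegral.integral_eq_sub_of_hasDerivAt hderiv (hcont.intervalIntegrable _ _)

/-- **Time primitives of even `C³` solutions are odd `C³` solutions.**  If `φ ∈ C³(ℝ²)` solves
`φ_tt − φ_xx + Vφ = 0` everywhere (slice `iteratedDeriv` form) and `φ_t(0,·) = 0`, then
`ψ(t,x) = ∫₀ᵗ φ(s,x) ds` is `C³`, solves the same equation, `ψ(0,·) = 0` and `ψ_t = φ`. -/
theorem timePrimitive_isSolution {V : ℝ → ℝ} (hφ : ContDiff ℝ 3 (uncurry φ))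
    (hsol : ∀ t x, iteratedDeriv 2 (fun τ => φ τ x) t - iteratedDeriv 2 (φ t) x + V x * φ t x = 0)
    (hφt0 : ∀ x, deriv (fun τ => φ τ x) 0 = 0) :
    ContDiff ℝ 3 (uncurry fun t x => ∫ s in (0 : ℝ)..t, φ s x) ∧
    (∀ t x, iteratedDeriv 2 (fun τ => ∫ s in (0 : ℝ)..τ, φ s x) t
        - iteratedDeriv 2 (fun y => ∫ s in (0 : ℝ)..t, φ s y) x
        + V x * (∫ s in (0 : ℝ)..t, φ s x) = 0) ∧
    (∀ x, (∫ s in (0 : ℝ)..(0 : ℝ), φ s x) = 0) ∧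
    (∀ t x, deriv (fun τ => ∫ s in (0 : ℝ)..τ, φ s x) t = φ t x) := by
  have hφ2 : ContDiff ℝ 2 (uncurry φ) := hφ.of_le (by norm_num)
  have hφc : Continuous (uncurry φ) := hφ.continuous
  refine ⟨contDiff_timePrimitive 3 hφ, fun t x => ?_, fun x => intervalIntegral.integral_same,
    fun t x => deriv_timePrimitive hφc t x⟩
  -- the equation for `φ` in Fréchet form
  have hpde : ∀ s, fderiv ℝ (fderiv ℝ (uncurry φ)) (s, x) (0, 1) (0, 1)
      = fderiv ℝ (fderiv ℝ (uncurry φ)) (s, x) (1, 0) (1, 0) + V x * φ s x := by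
    intro s
    have h := hsol s x
    rw [iteratedDeriv_two_slice_fst_eq hφ2, iteratedDeriv_two_slice_snd_eq hφ2] at h
    linarith
  -- ψ_tt = φ_t
  have htt : iteratedDeriv 2 (fun τ => ∫ s in (0 : ℝ)..τ, φ s x) t
      = fderiv ℝ (uncurry φ) (t, x) (1, 0) := by
    rw [iteratedDeriv_succ, iteratedDeriv_one]
    have h1 : deriv (fun τ => ∫ s in (0 : ℝ)..τ, φ s x) = fun τ => φ τ x :=
      funext fun τ => deriv_timePrimitive hφc τ x
    rw [h1, deriv_slice_fst_eq hφ2]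
  -- ψ_xx = φ_t + V ψ
  have hxx : iteratedDeriv 2 (fun y => ∫ s in (0 : ℝ)..t, φ s y) x
      = fderiv ℝ (uncurry φ) (t, x) (1, 0) + V x * ∫ s in (0 : ℝ)..t, φ s x := by
    rw [iteratedDeriv_two_timePrimitive_snd hφ2]
    have h1 : (∫ s in (0 : ℝ)..t, fderiv ℝ (fderiv ℝ (uncurry φ)) (s, x) (0, 1) (0, 1))
        = ∫ s in (0 : ℝ)..t, (fderiv ℝ (fderiv ℝ (uncurry φ)) (s, x) (1, 0) (1, 0) + V x * φ s x) :=
      intervalIntegral.integral_congr fun s _ => hpde s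
    have hc1 : Continuous fun σ : ℝ => fderiv ℝ (fderiv ℝ (uncurry φ)) (σ, x) (1, 0) (1, 0) := by
      have hc : Continuous (fderiv ℝ (fderiv ℝ (uncurry φ))) :=
        (hφ2.fderiv_right (m := 1) le_rfl).continuous_fderiv (by simp)
      exact ((hc.comp (continuous_id.prodMk continuous_const)).clm_apply continuous_const).clm_apply
        continuous_const
    have hc2 : Continuous fun σ : ℝ => V x * φ σ x :=
      continuous_const.mul (hφc.comp (continuous_id.prodMk continuous_const))
    rw [h1, intervalIntegral.integral_add (hc1.intervalIntegrable _ _) (hc2.intervalIntegrable _ _),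
      integral_fderiv_fderiv_fst hφ2, intervalIntegral.integral_const_mul]
    have h0 : fderiv ℝ (uncurry φ) (0, x) (1, 0) = 0 := by
      rw [← deriv_slice_fst_eq hφ2 0 x]
      exact hφt0 x
    rw [h0, sub_zero]
  rw [htt, hxx]
  ring

/-! ### The Regge–Wheeler instance: the registered stub `stub_rwCauchyC3` -/

open Literature.Geometry.Lorentzian Literature.Geometry.Lorentzian.ReggeWheeler

/-- **The `1+1` Cauchy problem for Regge–Wheeler with ODD, compactly supported `C³` data** (the
registered stub `stub_rwCauchyC3` of line `kruskal-rest-frame-virial`, crux K1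
stmt-FinalStateConjecture-10045, verbatim): along a tortoise radius function and for `s ≤ ℓ`, `g ∈ C³`
vanishing off `(α, β)`, there is a GLOBAL `C³` solution `ψ` of `ψ_tt − ψ_xx + V_{s,ℓ}(r x)ψ = 0` with
`ψ(0,·) = 0`, `ψ_t(0,·) = g`, supported in `{α − |t| ≤ x ≤ β + |t|}` (closed form).  Proof: the time
primitive (`timePrimitive_isSolution`) of the even `C³` solution with data `(g, 0)`
(`Blindness.exists_even_solution_C3`; `V` is `C²` and bounded along a tortoise radius function). -/
theorem rw_exists_odd_solution_C3 {M : ℝ} {r : ℝ → ℝ} {xc : ℝ} (hr : IsTortoiseRadius M r xc)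
    (s ℓ : ℕ) (hsℓ : s ≤ ℓ) (g : ℝ → ℝ) (hg : ContDiff ℝ 3 g) (α β : ℝ)
    (hsupp : ∀ x, x ≤ α ∨ β ≤ x → g x = 0) :
    ∃ ψ : ℝ → ℝ → ℝ, IsRWSolution M s ℓ r ψ ∧ ContDiff ℝ 3 (Function.uncurry ψ) ∧
      (∀ x, ψ 0 x = 0) ∧ (∀ x, deriv (fun τ => ψ τ x) 0 = g x) ∧
      ∀ t x, (x + |t| ≤ α ∨ β + |t| ≤ x) → ψ t x = 0 := by
  set V : ℝ → ℝ := linePotential M s ℓ r with hV_def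
  have hV2 : ContDiff ℝ 2 V := KruskalRestFrameVirial.contDiff_linePotential hr s ℓ 2
  have hVb : ∀ x, |V x| ≤ ((ℓ : ℝ) * ((ℓ : ℝ) + 1) + 1) / (2 * M) ^ 2 :=
    fun x => CauchyWave.abs_linePotential_le hr hsℓ x
  have hg0 : ∀ x, x ∉ Icc α β → g x = 0 := fun x hx => by
    apply hsupp
    by_contra hcon
    push Not at hcon
    exact hx ⟨hcon.1.le, hcon.2.le⟩
  obtain ⟨φ, hφ3, hφsol, hφ0, hφt, -, hφsupp⟩ :=
    Blindness.exists_even_solution_C3 (V := V) hV2 hVb hg hg0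
  obtain ⟨hψ3, hψsol, hψ0, hψt⟩ := timePrimitive_isSolution (V := V) hφ3 hφsol hφt
  refine ⟨fun t x => ∫ s in (0 : ℝ)..t, φ s x, ⟨hψ3.of_le (by norm_num), fun z => hψsol z.1 z.2⟩,
    hψ3, hψ0, fun x => by rw [hψt 0 x, hφ0 x], fun t x htx => ?_⟩
  -- support: the integrand vanishes for `s` between `0` and `t`
  have hφcont : ∀ τ, Continuous (φ τ) := fun τ =>
    hφ3.continuous.comp (continuous_const.prodMk continuous_id)
  have hφzero := CauchyWave.eq_zero_of_closed_support hφcont hφsupp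
  show (∫ s in (0 : ℝ)..t, φ s x) = 0
  have hvan : ∀ s ∈ uIcc (0 : ℝ) t, φ s x = 0 := by
    intro s hs
    have hst : |s| ≤ |t| := by
      rcases le_total 0 t with ht | ht
      · rw [uIcc_of_le ht] at hs
        rw [abs_of_nonneg hs.1, abs_of_nonneg ht]
        exact hs.2
      · rw [uIcc_of_ge ht] at hs
        rw [abs_of_nonpos hs.2, abs_of_nonpos ht]
        linarith [hs.1]
    refine hφzero s x ?_
    rcases htx with h | h
    · left; linarith
    · right; linarith
  rw [intervalIntegral.integral_congr (g := fun _ => (0 : ℝ)) hvan]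
  simp

/-- **Registered stub `stub_rwCauchyC3`** of line `kruskal-rest-frame-virial` (crux K1,
stmt-FinalStateConjecture-10045), name and signature verbatim: the `1+1` Regge–Wheeler Cauchy problem
with odd, compactly supported `C³` data `(0, g)`, global `C³` solution with light-cone support
(`= rw_exists_odd_solution_C3`). -/
theorem stub_rwCauchyC3 {M : ℝ} {r : ℝ → ℝ} {xc : ℝ} (hr : IsTortoiseRadius M r xc)
    (s ℓ : ℕ) (hsℓ : s ≤ ℓ) (g : ℝ → ℝ) (hg : ContDiff ℝ 3 g) (α β : ℝ)
    (hsupp : ∀ x, x ≤ α ∨ β ≤ x → g x = 0) :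
    ∃ ψ : ℝ → ℝ → ℝ, IsRWSolution M s ℓ r ψ ∧ ContDiff ℝ 3 (Function.uncurry ψ) ∧
      (∀ x, ψ 0 x = 0) ∧ (∀ x, deriv (fun τ => ψ τ x) 0 = g x) ∧
      ∀ t x, (x + |t| ≤ α ∨ β + |t| ≤ x) → ψ t x = 0 :=
  rw_exists_odd_solution_C3 hr s ℓ hsℓ g hg α β hsupp

end WaveEnergy

end Summit.FinalStateConjecture.FinalStateConjecture.Theorems

end
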